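import Literature.NumberTheory.GaloisRepresentations.AbsGaloisOuterConj
import Literature.NumberTheory.GaloisRepresentations.DecompositionGroupOfCompletion
import Literature.NumberTheory.Automorphic.AdicCompletionResidueCard

/-!
# Stub `stub_inertFrobeniusTransport`, embedding lemmas (line `inert-fl-transfer`, crux
`ResidueParallel`, stmt-Langlands-17003)

Bookkeeping for reading the local Kummer / fundamental characters of `F_v` inside `\bar ℚ` (file
`NonParallelVoidResidueParallelStubInertFrobeniusTransport.lean`), for a number field `F` and a
finite place `v`, along the chosen embeddings `\bar ℚ → \bar F → \bar F_v`
(`absClosureEmbedding`):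

* `inertFrob_exists_smul_sub_not_mem` — for `F/ℚ` Galois, `e(v|p) = 1` and `c ≠ 1` in `Gal(F/ℚ)`,
  some `y ∈ 𝓞 F` has `c y - y ∉ v` (the inertia group of `v` has order `e(v|p)`, Mathlib
  `Ideal.card_inertia_eq_ramificationIdxIn`); `inertFrob_pow_sq_sub_mem` — for `f(v|p) = 2`,
  `y ^ (p ^ 2) ≡ y (mod v)`;
* `inertFrob_absClosureEmbedding_mem` — `\bar ℤ_ℚ → \bar ℤ_F → \bar F_v` lands in the absolute
  integers of the local field `F_v`; `inertFrob_smul_emb` — `Γ_{F_v}` acts on the image of `\bar ℚ`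
  through `R ∘ res_v : Γ_{F_v} → Γ_F → Γ_ℚ`; `inertFrob_emb_mem_absMaximalIdeal_iff` — the prime of
  `\bar F_v` pulls back to `𝔓₁ = ι⁻¹ 𝔓_v ⊂ \bar ℤ_ℚ`; `inertFrob_absEmbeddingInt_mem_iff` — on `𝓞 F`
  the prime `𝔓₁` cuts out `v`;
* `inertFrob_exists_preimage` — a root of `X ^ n - p` in `\bar F_v` is the image of a root in `\bar ℚ`.

References: J. Neukirch, *Algebraic Number Theory* (1999), Ch. I §9, Ch. II §8–§9 (primes above `v`
and embeddings into `\bar F_v`).  No `sorry`, no new definitions.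
-/

-- project-wide option (lakefile weak.linter.dupNamespace); `Summit.Langlands.Langlands` is mandated
set_option linter.dupNamespace false

noncomputable section

open scoped NumberField Pointwise
open Literature.NumberTheory.GaloisRepresentations
open Literature.NumberTheory.GaloisRepresentations.IsNonarchimedeanLocalField (absMaximalIdeal)
open Field IsDedekindDomain NumberField ValuativeRel Polynomial

namespace Summit.Langlands.Langlands.Cruxes.ResidueParallel.InertFLTransfer

-- The `v`-adic norm on `F_v` is Mathlib's scoped instance `Valued.toNontriviallyNormedField`,
-- switched on by `open scoped Valued in` where needed; since that scope also has an `𝒪[·]`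
-- notation clashing with the `ValuativeRel` one, those statements spell out
-- `(valuation F_v).integer` for `𝒪[F_v]`.

/-! ### The quadratic field: `τ̄` moves `𝓞 F / v` -/

section NumberFieldSide

variable {F : Type} [Field F] [NumberField F]

/-- For a Galois number field `F`, a place `v` above `p` with `e(v|p) = 1` and `c ≠ 1` in
`Gal(F/ℚ)`, some `y ∈ 𝓞 F` has `c y - y ∉ v`: the inertia group of `v` in `Gal(F/ℚ)` has order
`e(v|p) = 1` (Mathlib `Ideal.card_inertia_eq_ramificationIdxIn`).
[cite: NeukirchANT1999, Ch. I §9 Prop. (9.6)] -/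
theorem inertFrob_exists_smul_sub_not_mem [IsGalois ℚ F] (p : ℕ) [Fact p.Prime]
    (v : HeightOneSpectrum (𝓞 F)) (hv : ((p : ℕ) : 𝓞 F) ∈ v.asIdeal)
    (he : v.asIdeal.ramificationIdx ℤ = 1) (c : F ≃ₐ[ℚ] F) (hc : c ≠ 1) :
    ∃ y : 𝓞 F, c • y - y ∉ v.asIdeal := by
  haveI : IsGaloisGroup (F ≃ₐ[ℚ] F) ℤ (𝓞 F) := IsGaloisGroup.of_isFractionRing _ _ _ ℚ F
  have hp : Prime (p : ℤ) := Nat.prime_iff_prime_int.mp Fact.out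
  haveI : v.asIdeal.LiesOver (Ideal.span {(p : ℤ)}) :=
    (Ideal.liesOver_span_iff v.isPrime.ne_top hp).2 (by simpa using hv)
  haveI : (Ideal.span {(p : ℤ)}).IsPrime := (Ideal.span_singleton_prime hp.ne_zero).2 hp
  have hcard : Nat.card (v.asIdeal.inertia (F ≃ₐ[ℚ] F)) = 1 := by
    rw [Ideal.card_inertia_eq_ramificationIdxIn (G := F ≃ₐ[ℚ] F) (Ideal.span {(p : ℤ)}) v.asIdeal,
      Ideal.ramificationIdxIn_eq_ramificationIdx (Ideal.span {(p : ℤ)}) v.asIdeal (F ≃ₐ[ℚ] F), he]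
  have hbot : v.asIdeal.inertia (F ≃ₐ[ℚ] F) = ⊥ := Subgroup.eq_bot_of_card_eq _ hcard
  by_contra! h
  have : c ∈ v.asIdeal.inertia (F ≃ₐ[ℚ] F) := fun y ↦ h y
  rw [hbot] at this
  exact hc (Subgroup.mem_bot.1 this)

/-- For a place `v` above `p` with `f(v|p) = 2`, `y ^ (p ^ 2) ≡ y (mod v)` on `𝓞 F`
(`#(𝓞 F / v) = p ^ 2`, Mathlib `Ideal.pow_inertiaDeg`, and `x ^ #k = x` in a finite field).
[folklore] -/
theorem inertFrob_pow_sq_sub_mem (p : ℕ) [Fact p.Prime] (v : HeightOneSpectrum (𝓞 F))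
    (hv : ((p : ℕ) : 𝓞 F) ∈ v.asIdeal) (hf : v.asIdeal.inertiaDeg ℤ = 2) (y : 𝓞 F) :
    y ^ (p ^ 2) - y ∈ v.asIdeal := by
  have hp : Prime (p : ℤ) := Nat.prime_iff_prime_int.mp Fact.out
  haveI : v.asIdeal.LiesOver (Ideal.span {(p : ℤ)}) :=
    (Ideal.liesOver_span_iff v.isPrime.ne_top hp).2 (by simpa using hv)
  haveI := v.isPrime
  have hnorm : Ideal.absNorm v.asIdeal = p ^ 2 := by
    rw [← hf]; exact (Ideal.pow_inertiaDeg p v.asIdeal).symm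
  haveI : v.asIdeal.IsMaximal := v.isMaximal
  letI : Field (𝓞 F ⧸ v.asIdeal) := Ideal.Quotient.field _
  haveI : Finite (𝓞 F ⧸ v.asIdeal) := Ideal.finiteQuotientOfFreeOfNeBot _ v.ne_bot
  letI : Fintype (𝓞 F ⧸ v.asIdeal) := Fintype.ofFinite _
  have hcard : Fintype.card (𝓞 F ⧸ v.asIdeal) = p ^ 2 := by
    rw [Fintype.card_eq_nat_card, ← Submodule.cardQuot_apply, ← Ideal.absNorm_apply, hnorm]
  rw [← Ideal.Quotient.eq_zero_iff_mem, map_sub, map_pow, ← hcard, FiniteField.pow_card, sub_self]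

end NumberFieldSide

/-! ### `\bar ℚ → \bar F → \bar F_v`: integers, the prime `𝔓₁ = ι⁻¹ 𝔓_v`, equivariance -/

section Transport

variable (F : Type) [Field F] [NumberField F] (v : HeightOneSpectrum (𝓞 F))

open scoped Valued in
/-- The valuation of `F_v` is `≤ 1` on `𝓞 F` (`adicCompletion_valuation_le_one_iff`,
`norm_algebraMap_ringOfIntegers_le_one`). [folklore] -/
theorem inertFrob_valuation_algebraMap_le_one (r : 𝓞 F) :
    valuation (v.adicCompletion F) (algebraMap (𝓞 F) (v.adicCompletion F) r) ≤ 1 :=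
  (adicCompletion_valuation_le_one_iff F v _).mpr (norm_algebraMap_ringOfIntegers_le_one F v r)

open scoped Valued in
/-- `\bar ℤ_ℚ → \bar ℤ_F → \bar F_v` lands in the absolute integers `\bar 𝒪_{F_v}` of the local field
(`absClosureEmbedding_mem_absIntegers_integer`). [folklore] -/
theorem inertFrob_absClosureEmbedding_mem (s : absIntegers (𝓞 ℚ) ℚ) :
    absClosureEmbedding F (v.adicCompletion F)
        ((absIntegersMap ℚ F s : absIntegers (𝓞 F) F) : AlgebraicClosure F) ∈
      absIntegers (valuation (v.adicCompletion F)).integer (v.adicCompletion F) :=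
  absClosureEmbedding_mem_absIntegers_integer F (v.adicCompletion F) (valuation (v.adicCompletion F))
    (inertFrob_valuation_algebraMap_le_one F v) (absIntegersMap ℚ F s)

open scoped Valued in
/-- **The prime of `\bar F_v` pulls back to `𝔓₁ = ι⁻¹ 𝔓_v ⊂ \bar ℤ_ℚ`**: for `s ∈ \bar ℤ_ℚ`, its image
in `\bar 𝒪_{F_v}` lies in the canonical prime `absMaximalIdeal F_v` iff `s ∈ ι⁻¹ 𝔓_v` (both are the
open unit ball of the spectral norm: `mem_radical_map_maximalIdeal_iff`,
`mem_adicCompletionPrime_iff`). [cite: NeukirchANT1999, Ch. II §8 Prop. (8.2)] -/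
theorem inertFrob_emb_mem_absMaximalIdeal_iff (s : absIntegers (𝓞 ℚ) ℚ) :
    (⟨absClosureEmbedding F (v.adicCompletion F)
        ((absIntegersMap ℚ F s : absIntegers (𝓞 F) F) : AlgebraicClosure F),
      inertFrob_absClosureEmbedding_mem F v s⟩ :
        absIntegers (valuation (v.adicCompletion F)).integer (v.adicCompletion F)) ∈
      absMaximalIdeal (v.adicCompletion F) ↔
    s ∈ (adicCompletionPrime F v).comap (absIntegersMap ℚ F) := by
  rw [Ideal.mem_comap, mem_adicCompletionPrime_iff]
  exact mem_radical_map_maximalIdeal_iff (adicCompletion_valuation_le_one_iff F v) _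

/-- **Equivariance**: `Γ_{F_v}` acts on the image of `\bar ℚ` in `\bar F_v` through
`R ∘ res_v : Γ_{F_v} → Γ_F → Γ_ℚ` (`absGaloisRestrict_apply_smul`, twice). [folklore] -/
theorem inertFrob_smul_emb (σ : absoluteGaloisGroup (v.adicCompletion F)) (y : AlgebraicClosure ℚ) :
    σ • absClosureEmbedding F (v.adicCompletion F) (absClosureEmbedding ℚ F y) =
      absClosureEmbedding F (v.adicCompletion F) (absClosureEmbedding ℚ F
        (absGaloisRestrict ℚ F (absGaloisRestrict F (v.adicCompletion F) σ) • y)) := by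
  rw [absGaloisRestrict_apply_smul, absGaloisRestrict_apply_smul]

/-- For `w ∈ 𝓞 F`: `ι⁻¹(w) ∈ 𝔓₁ = ι⁻¹ 𝔓_v ↔ w ∈ v` (`𝔓_v ∩ 𝓞 F = v`, `under_adicCompletionPrime`).
[folklore] -/
theorem inertFrob_absEmbeddingInt_mem_iff (w : 𝓞 F) :
    absEmbeddingInt ℚ F w ∈ (adicCompletionPrime F v).comap (absIntegersMap ℚ F) ↔
      w ∈ v.asIdeal := by
  rw [Ideal.mem_comap, absIntegersMap_absEmbeddingInt, ← under_adicCompletionPrime F v,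
    Ideal.under_def, Ideal.mem_comap]

/-- **Roots of `X ^ n - p` in `\bar F_v` come from `\bar ℚ`**: an element `z` of `\bar F_v` with
`z ^ n = p` (`n > 0`) is the image of some `y ∈ \bar ℚ` with `y ^ n = p` (the roots of a
polynomial over `F` lie in the image of `\bar F`, `mem_range_of_aeval_eq_zero`, and `\bar ℚ ≅ \bar F`).
[folklore] -/
theorem inertFrob_exists_preimage {n : ℕ} (hn : 0 < n) (p : ℕ)
    (z : AlgebraicClosure (v.adicCompletion F))
    (hz : z ^ n = (p : AlgebraicClosure (v.adicCompletion F))) :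
    ∃ y : AlgebraicClosure ℚ,
      absClosureEmbedding F (v.adicCompletion F) (absClosureEmbedding ℚ F y) = z ∧ y ^ n = p := by
  have hg : (X ^ n - C (p : F) : F[X]) ≠ 0 := Polynomial.X_pow_sub_C_ne_zero hn _
  have hb : aeval z (X ^ n - C (p : F) : F[X]) = 0 := by simp [hz]
  obtain ⟨zF, hzF⟩ := mem_range_of_aeval_eq_zero (absClosureEmbedding F (v.adicCompletion F)) hg hb
  obtain ⟨y, rfl⟩ := (absClosureEmbedding_bijective ℚ F).2 zF
  refine ⟨y, hzF, ?_⟩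
  have hinj : Function.Injective fun t ↦
      absClosureEmbedding F (v.adicCompletion F) (absClosureEmbedding ℚ F t) :=
    (absClosureEmbedding F (v.adicCompletion F)).injective.comp (absClosureEmbedding ℚ F).injective
  apply hinj
  simp only [map_pow, map_natCast, hzF, hz]

end Transport

end Summit.Langlands.Langlands.Cruxes.ResidueParallel.InertFLTransfer

end
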